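import Literature.Analysis.Asymptotics.LaplaceMethodChartComposition
import Literature.Analysis.InnerProduct.OrthogonalSumJacobian
import HarnessLib

/-!
# Chart identities whose parameter space is a LINEAR MODEL of the frame (e.g. a product `E × F` with the
# product Lebesgue measure): `C¹` reparametrisations of an additive Haar measure and of the exponential
# chart of a compact group

[STATUS: formal-restatement] [support] [H3] [topic Analysis/Asymptotics]

Sequel of `LaplaceMethodChartComposition.lean` (theorems only; no definitions, no named facts).  There the
`C¹` reparametrisation `Ψ` of the frame space `V` of an exponential chart was a map `V → V` and the reference
measure was the Lebesgue measure of `V`.  For tubular ∕ gauge-fixed coordinates around an orbit the natural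
parameter space is a PRODUCT `P = E × F` («gauge parameters × transversal slice») carrying the PRODUCT of
Lebesgue measures — the format consumed by `MeasureTheory/Group/OrbitTubeMeasure.lean` (`hloc`) and by
`tendsto_laplaceMethod_fibred_chart` ∕ `tendsto_laplaceMethod_orbit` — related to the frame by a linear
isomorphism `κ : P ≃L[ℝ] V` with a known Jacobian constant (`Analysis/InnerProduct/OrthogonalSumJacobian.lean`:
`dw = D · κ_*(dφ ⊗ dy)`, `D = √det(T†T)·√det(U†U)` for the orthogonal sum `κ(φ, y) = Tφ + Uy`).  This file
transports the chart identities along such a LINEAR MODEL `(P, μ_P, κ, D)`: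

* §1 `restrict_image_eq_map_withDensity_of_linearModel` (+ `_ofReal`) — for an additive Haar measure `μ_V` on a
  finite-dimensional `V`, any measure `μ_P` on `P` with `μ_V = D · κ_* μ_P`, and `Ψ : P → V` measurable,
  injective on a measurable `W` with derivative `Ψ' z : P →L V` within `W`:
  `μ_V|_{Ψ(W)} = Ψ_*((D · |det(Ψ'(z) ∘ κ⁻¹)|) · μ_P|_W)`  (the change of variables for `Ψ ∘ κ⁻¹ : V → V`,
  then the linear chart `κ`);  `measurableSet_image_of_hasFDerivWithinAt_linearModel`.
* §2 ★★ `haar_restrict_image_reparam_eq_map_withDensity_linearModel` — composed with the translated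
  exponential chart `z ↦ g₀ · Θ(e(Ψ z))` of a compact group faithfully represented on a log-charted linear group
  (`IsChartRep`): `μ|_{(g₀Θ∘e∘Ψ)(W)} = (g₀Θ∘e∘Ψ)_*((|det(Ψ'(z)∘κ⁻¹)| · D · σ₀ · |det jac(e Ψ z)|) · μ_P|_W)`.
* §3 the ORTHOGONAL-SUM model `P = E × F`, `μ_P = dφ ⊗ dy`, `κ(φ, y) = Tφ + Uy`:
  `exists_continuousLinearEquiv_of_orthogonal` (the model as a `≃L`), `volume_restrict_image_eq_map_withDensity_prod`,
  ★★ `haar_restrict_image_reparam_eq_map_withDensity_prod` — literally the `hloc` hypothesis of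
  `OrbitTubeMeasure.restrict_tube_eq_map_withDensity_ofReal` ∕ `tendsto_laplaceMethod_orbit` for
  `Θ'(φ, y) = g₀ · Θ(e(Ψ(φ, y)))`, with density `|det(Ψ'(φ,y) ∘ κ⁻¹)| · (√det(T†T)·√det(U†U)) · σ₀ · |det jac|`
  against `(dφ ⊗ dy)|_W`.

[cite: Breitung1994, §2.3 Definitions 4–5 pp. 14–15 (regular transformations ∕ local coordinates); Thm 41 p. 56]
[cite: EvansGariepy2015, §3.3.1 Lemma 3.1 and §3.3.3 (linear and `C¹` changes of variables) (PDF pp. 74, 78)]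
[cite: Helgason2000, Ch. I §1 Thm 1.14 (13) p. 96 (Haar measure in exponential coordinates)]

HONEST SCOPE: measure-theoretic plumbing; nothing asymptotic, nothing about lattice gauge theory or the Yang–Mills
mass gap (Clay), which is NOT proved; `R4` closes only the conditional finite-`𝕋⁴` rung `BalabanLadder.UV`.
-/

noncomputable section

namespace Literature.Analysis.Asymptotics

open _root_.MeasureTheory _root_.MeasureTheory.Measure _root_.Set _root_.Filter _root_.Topology
open scoped _root_.ENNReal _root_.NNReal _root_.InnerProductSpace
open Literature.MathematicalPhysics.QuantumFieldTheory.Balaban1983to89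
open Literature.MathematicalPhysics.QuantumFieldTheory.Balaban1983to89.HaarExponentialChart
open Literature.MathematicalPhysics.QuantumFieldTheory.Balaban1983to89.B13HaarSigmaJacobian (jac)
open Literature.Analysis.InnerProduct

/-! ## §1 `C¹` reparametrisations parametrised by a linear model -/

section LinearModel

variable {P V : Type*} [NormedAddCommGroup P] [NormedSpace ℝ P] [FiniteDimensional ℝ P]
  [MeasurableSpace P] [BorelSpace P]
  [NormedAddCommGroup V] [NormedSpace ℝ V] [FiniteDimensional ℝ V] [MeasurableSpace V] [BorelSpace V]
  (μV : Measure V) [μV.IsAddHaarMeasure] (μP : Measure P) (κ : P ≃L[ℝ] V)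

omit [FiniteDimensional ℝ P] [FiniteDimensional ℝ V] [μV.IsAddHaarMeasure] in
/-- **A linear model is a chart**: from `μ_V = D · κ_* μ_P`, for every measurable `W ⊆ P`,
`μ_V|_{κ(W)} = κ_*(D · μ_P|_W)`. [cite: EvansGariepy2015, §3.3.1 Lemma 3.1 (PDF p. 74)] -/
theorem restrict_image_linearModel_eq_map_withDensity {D : ℝ≥0∞} (hκ : μV = D • μP.map κ) {W : Set P}
    (hW : MeasurableSet W) :
    μV.restrict (κ '' W) = ((μP.restrict W).withDensity fun _ => D).map κ := by
  have hemb : MeasurableEmbedding κ := κ.toHomeomorph.measurableEmbedding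
  rw [hκ, Measure.restrict_smul, Measure.restrict_map hemb.measurable (hemb.measurableSet_image.2 hW),
    Set.preimage_image_eq W hemb.injective, withDensity_const, Measure.map_smul]

omit [MeasurableSpace P] [BorelSpace P] [MeasurableSpace V] [BorelSpace V] [FiniteDimensional ℝ P]
  [FiniteDimensional ℝ V] in
/-- The derivative of `Ψ ∘ κ⁻¹` within `κ(W)`. [cite: EvansGariepy2015, §3.3.3 (PDF p. 78)] -/
theorem hasFDerivWithinAt_comp_symm_linearModel {Ψ : P → V} {W : Set P} {Ψ' : P → P →L[ℝ] V}
    (hΨ' : ∀ z ∈ W, HasFDerivWithinAt Ψ (Ψ' z) W z) (w : V) (hw : w ∈ κ '' W) :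
    HasFDerivWithinAt (Ψ ∘ κ.symm) ((Ψ' (κ.symm w)).comp (κ.symm : V →L[ℝ] P)) (κ '' W) w := by
  obtain ⟨z, hz, rfl⟩ := hw
  have h1 : HasFDerivWithinAt Ψ (Ψ' (κ.symm (κ z))) W (κ.symm (κ z)) := by
    rw [κ.symm_apply_apply]
    exact hΨ' z hz
  refine h1.comp (κ z) (κ.symm : V →L[ℝ] P).hasFDerivWithinAt ?_
  rintro _ ⟨z', hz', rfl⟩
  simpa using hz'

omit [FiniteDimensional ℝ V] [μV.IsAddHaarMeasure] in
/-- The image `Ψ(W)` is measurable (Lusin–Souslin). [cite: Breitung1994, §2.3 Definitions 4–5 pp. 14–15] -/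
theorem measurableSet_image_of_hasFDerivWithinAt_linearModel {Ψ : P → V} {W : Set P}
    {Ψ' : P → P →L[ℝ] V} (hW : MeasurableSet W) (hΨ' : ∀ z ∈ W, HasFDerivWithinAt Ψ (Ψ' z) W z)
    (hinj : InjOn Ψ W) : MeasurableSet (Ψ '' W) :=
  hW.image_of_continuousOn_injOn (fun z hz => (hΨ' z hz).continuousWithinAt) hinj

/-- ★ **Change of variables through a linear model, as a chart identity.**  Let `μ_V` be an additive Haar measure
on a finite-dimensional real normed space `V`, `κ : P ≃L[ℝ] V` a linear model with `μ_V = D · κ_* μ_P` for a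
measure `μ_P` on `P` (e.g. `P = E × F` with the product Lebesgue measure and `D` the Gram constant of
`OrthogonalSumJacobian.volume_eq_smul_map_prod_volume`), and `Ψ : P → V` measurable, injective on a measurable
`W` with derivative `Ψ' z : P →L V` within `W` at every `z ∈ W`, `z ↦ |det(Ψ'(z) ∘ κ⁻¹)|` measurable.  Then
`μ_V|_{Ψ(W)} = Ψ_*((D · |det(Ψ'(z) ∘ κ⁻¹)|) · μ_P|_W)`.
[cite: Breitung1994, §2.3 Definitions 4–5 pp. 14–15; Thm 41 p. 56]
[cite: EvansGariepy2015, §3.3.1 Lemma 3.1 and §3.3.3 (PDF pp. 74, 78)] -/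
theorem restrict_image_eq_map_withDensity_of_linearModel {D : ℝ≥0∞} (hκ : μV = D • μP.map κ)
    {Ψ : P → V} {W : Set P} {Ψ' : P → P →L[ℝ] V} (hΨm : Measurable Ψ) (hW : MeasurableSet W)
    (hΨ' : ∀ z ∈ W, HasFDerivWithinAt Ψ (Ψ' z) W z) (hinj : InjOn Ψ W)
    (hΨ'm : Measurable fun z => |((Ψ' z).comp (κ.symm : V →L[ℝ] P)).det|) :
    μV.restrict (Ψ '' W) =
      ((μP.restrict W).withDensity fun z =>
        D * ENNReal.ofReal |((Ψ' z).comp (κ.symm : V →L[ℝ] P)).det|).map Ψ := by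
  have hemb : MeasurableEmbedding κ := κ.toHomeomorph.measurableEmbedding
  have hκW : MeasurableSet (κ '' W) := hemb.measurableSet_image.2 hW
  -- the reparametrisation in the frame: `Ψ ∘ κ⁻¹ : V → V` on `κ(W)`
  have hΨV' := hasFDerivWithinAt_comp_symm_linearModel κ hΨ'
  have hinjV : InjOn (Ψ ∘ κ.symm) (κ '' W) := by
    rintro _ ⟨z₁, hz₁, rfl⟩ _ ⟨z₂, hz₂, rfl⟩ heq
    simp only [Function.comp_apply, ContinuousLinearEquiv.symm_apply_apply] at heq
    rw [hinj hz₁ hz₂ heq]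
  have hV := addHaar_restrict_image_eq_map_withDensity_of_hasFDerivWithinAt μV hκW hΨV' hinjV
  -- the linear chart `κ`
  have hlin := restrict_image_linearModel_eq_map_withDensity μV μP κ hκ hW
  -- compose the two chart identities
  have hΨVm : Measurable (Ψ ∘ κ.symm) := hΨm.comp κ.symm.continuous.measurable
  have hJ₁m : Measurable fun w : V =>
      ENNReal.ofReal |((Ψ' (κ.symm w)).comp (κ.symm : V →L[ℝ] P)).det| :=
    (hΨ'm.comp κ.symm.continuous.measurable).ennreal_ofReal
  have himg : (Ψ ∘ κ.symm) '' (κ '' W) = Ψ '' W := by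
    rw [Set.image_image]
    simp only [Function.comp_apply, ContinuousLinearEquiv.symm_apply_apply]
  have hΘΨW : MeasurableSet ((Ψ ∘ κ.symm) '' (κ '' W)) := by
    rw [himg]
    exact measurableSet_image_of_hasFDerivWithinAt_linearModel hW hΨ' hinj
  have hcomp := chart_comp_of_injOn hΨVm κ.continuous.measurable hinjV hJ₁m measurable_const Subset.rfl
    hΘΨW hV hlin
  simpa only [Function.comp_def, ContinuousLinearEquiv.symm_apply_apply] using hcomp

/-- The same with a REAL constant `D ≥ 0` and real densities (`ENNReal.ofReal`), the format of
`tendsto_laplaceMethod_chart` ∕ `OrbitTubeMeasure.restrict_tube_eq_map_withDensity_ofReal`: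
`μ_V|_{Ψ(W)} = Ψ_*((|det(Ψ'(z) ∘ κ⁻¹)| · D) · μ_P|_W)`.
[cite: Breitung1994, §2.3 Definitions 4–5 pp. 14–15] [cite: EvansGariepy2015, §3.3.3 (PDF p. 78)] -/
theorem restrict_image_eq_map_withDensity_of_linearModel_ofReal {D : ℝ}
    (hκ : μV = ENNReal.ofReal D • μP.map κ)
    {Ψ : P → V} {W : Set P} {Ψ' : P → P →L[ℝ] V} (hΨm : Measurable Ψ) (hW : MeasurableSet W)
    (hΨ' : ∀ z ∈ W, HasFDerivWithinAt Ψ (Ψ' z) W z) (hinj : InjOn Ψ W)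
    (hΨ'm : Measurable fun z => |((Ψ' z).comp (κ.symm : V →L[ℝ] P)).det|) :
    μV.restrict (Ψ '' W) =
      ((μP.restrict W).withDensity fun z =>
        ENNReal.ofReal (|((Ψ' z).comp (κ.symm : V →L[ℝ] P)).det| * D)).map Ψ := by
  rw [restrict_image_eq_map_withDensity_of_linearModel μV μP κ hκ hΨm hW hΨ' hinj hΨ'm]
  congr 2
  funext z
  rw [ENNReal.ofReal_mul (abs_nonneg _), mul_comm]

end LinearModel

/-! ## §2 Compact groups: Haar measure in `C¹` coordinates parametrised by a linear model -/

section Group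

variable {𝔸 : Type*} [NormedRing 𝔸] [NormedAlgebra ℂ 𝔸] [CompleteSpace 𝔸]
variable {G : Type*} [Group G] [TopologicalSpace G] [IsTopologicalGroup G] [CompactSpace G]
  [MeasurableSpace G] [BorelSpace G]
variable {C : LogChart 𝔸} {ρ : G →* 𝔸} (h : IsChartRep C ρ) [FiniteDimensional ℝ C.lie]
  (hlie : ∀ x ∈ C.lie, ∀ y ∈ C.lie, x * y - y * x ∈ C.lie)
variable [MeasurableSpace C.lie] [BorelSpace C.lie]
variable (μ : Measure G) [μ.IsHaarMeasure]
variable {V : Type*} [NormedAddCommGroup V] [InnerProductSpace ℝ V] [FiniteDimensional ℝ V]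
  [MeasurableSpace V] [BorelSpace V] (e : V ≃L[ℝ] C.lie)
variable {P : Type*} [NormedAddCommGroup P] [NormedSpace ℝ P] [FiniteDimensional ℝ P]
  [MeasurableSpace P] [BorelSpace P] (μP : Measure P) (κ : P ≃L[ℝ] V)

include hlie in
/-- ★★ **Haar measure in `C¹` coordinates parametrised by a linear model of the frame.**  For every Haar measure
`μ` on the compact group `G` (faithfully represented, `h : IsChartRep C ρ`), frame `e : V ≃L[ℝ] 𝔤`, base point `g₀`,
linear model `κ : P ≃L[ℝ] V` with `dv = D · κ_* μ_P` (`D ≥ 0`), and a reparametrisation `Ψ : P → V` measurable,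
injective on a measurable `W` with derivative `Ψ'` within `W` and `Ψ(W) ⊆ e⁻¹B(0, s_C∕2)`:
`μ|_{(g₀Θ∘e∘Ψ)(W)} = (g₀Θ∘e∘Ψ)_*((|det(Ψ'(z) ∘ κ⁻¹)| · D · σ₀ · |det jac(e Ψ z)|) · μ_P|_W)` — the `hchart` ∕ `hloc`
hypothesis of the Laplace and orbit-tube files with the parameter measure `μ_P`.
[cite: Helgason2000, Ch. I §1 Thm 1.14 (13) p. 96] [cite: Breitung1994, §2.3 Definitions 4–5 pp. 14–15; Thm 41 p. 56] -/
theorem haar_restrict_image_reparam_eq_map_withDensity_linearModel (g₀ : G) {D : ℝ} (hD : 0 ≤ D)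
    (hκ : (volume : Measure V) = ENNReal.ofReal D • μP.map κ)
    {Ψ : P → V} {W : Set P} {Ψ' : P → P →L[ℝ] V} (hΨm : Measurable Ψ) (hW : MeasurableSet W)
    (hΨ' : ∀ z ∈ W, HasFDerivWithinAt Ψ (Ψ' z) W z) (hinj : InjOn Ψ W)
    (hΨ'm : Measurable fun z => |((Ψ' z).comp (κ.symm : V →L[ℝ] P)).det|)
    (hΨW : Ψ '' W ⊆ e ⁻¹' Metric.ball (0 : C.lie) (IsChartRep.chartRadius C / 2)) :
    μ.restrict ((fun z => g₀ * h.expChart (e (Ψ z))) '' W) =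
      ((μP.restrict W).withDensity fun z => ENNReal.ofReal
          (|((Ψ' z).comp (κ.symm : V →L[ℝ] P)).det| * D *
            ((μ (h.window (IsChartRep.chartRadius C)) /
                h.chartMeasure hlie ((volume : Measure V).map e) (IsChartRep.chartRadius C)
                  (h.window (IsChartRep.chartRadius C))).toReal *
              |LinearMap.det (jac hlie (e (Ψ z)) : C.lie →ₗ[ℝ] C.lie)|))).map
        (fun z => g₀ * h.expChart (e (Ψ z))) := by
  set Θ : V → G := fun v => g₀ * h.expChart (e v) with hΘ_def
  have hΘm : Measurable Θ := (h.measurable_expChart.comp e.continuous.measurable).const_mul g₀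
  have hcomp : (fun z => g₀ * h.expChart (e (Ψ z))) = Θ ∘ Ψ := rfl
  have hs2 : IsChartRep.chartRadius C / 2 ≤ IsChartRep.chartRadius C := by
    linarith [IsChartRep.chartRadius_pos (C := C)]
  -- measurability of the image `Θ(Ψ W)`: Lusin–Souslin on `𝔤`, then left translation
  have hΨWm : MeasurableSet (Ψ '' W) := measurableSet_image_of_hasFDerivWithinAt_linearModel hW hΨ' hinj
  have heΨW : MeasurableSet ((e : V → C.lie) '' (Ψ '' W)) :=
    e.toHomeomorph.toMeasurableEquiv.measurableSet_image.2 hΨWm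
  have hinj' : InjOn h.expChart ((e : V → C.lie) '' (Ψ '' W)) := (h.injOn_expChart hs2).mono (by
    rintro _ ⟨v, hv, rfl⟩
    exact hΨW hv)
  have hΘΨW : MeasurableSet (Θ '' (Ψ '' W)) := by
    have himg : Θ '' (Ψ '' W) = (fun x => g₀ * x) '' (h.expChart '' ((e : V → C.lie) '' (Ψ '' W))) := by
      simp only [hΘ_def, Set.image_image]
    rw [himg, Set.image_mul_left]
    exact (measurable_const_mul g₀⁻¹) (h.measurableSet_image_expChart heΨW hinj')
  -- the density of the frame chart is measurable (indeed continuous)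
  have hJ : Measurable fun v : V =>
      (μ (h.window (IsChartRep.chartRadius C)) /
          h.chartMeasure hlie ((volume : Measure V).map e) (IsChartRep.chartRadius C)
            (h.window (IsChartRep.chartRadius C))).toReal *
        |LinearMap.det (jac hlie (e v) : C.lie →ₗ[ℝ] C.lie)| :=
    (continuous_const.mul ((continuous_det_jac hlie).comp e.continuous).abs).measurable
  have hΨchart := restrict_image_eq_map_withDensity_of_linearModel_ofReal (volume : Measure V) μP κ hκ hΨm
    hW hΨ' hinj hΨ'm
  have hmain := chart_comp_of_injOn_ofReal (μ := μ) hΘm hΨm (injOn_translate_expChart_frame h e g₀) hJ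
    (hΨ'm.mul measurable_const) (fun z => mul_nonneg (abs_nonneg _) hD) hΨW hΘΨW
    (haar_restrict_translate_window_eq_map_withDensity_frame h hlie μ e g₀) hΨchart
  simp only [Pi.mul_apply] at hmain
  rw [hcomp, hmain]

end Group

/-! ## §3 The orthogonal-sum model `P = E × F`, `μ_P = dφ ⊗ dy` -/

section Prod

variable {E F V : Type*}
  [NormedAddCommGroup E] [InnerProductSpace ℝ E] [FiniteDimensional ℝ E] [MeasurableSpace E] [BorelSpace E]
  [NormedAddCommGroup F] [InnerProductSpace ℝ F] [FiniteDimensional ℝ F] [MeasurableSpace F] [BorelSpace F]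
  [NormedAddCommGroup V] [InnerProductSpace ℝ V] [FiniteDimensional ℝ V] [MeasurableSpace V] [BorelSpace V]
  {T : E →ₗ[ℝ] V} {U : F →ₗ[ℝ] V}

omit [MeasurableSpace E] [BorelSpace E] [MeasurableSpace F] [BorelSpace F] [MeasurableSpace V] [BorelSpace V]
  [FiniteDimensional ℝ V] in
/-- **The orthogonal-sum model as a continuous linear equivalence**: for injective `T, U` with orthogonal ranges
spanning `V` there is `κ : E × F ≃L[ℝ] V` with `κ(φ, y) = Tφ + Uy` (to be fed to the `_linearModel` theorems
together with `OrthogonalSumJacobian.volume_eq_smul_map_prod_volume`).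
[cite: EvansGariepy2015, §3.3.1 Lemma 3.1 (PDF p. 74)] -/
theorem exists_continuousLinearEquiv_of_orthogonal (hT : Function.Injective T) (hU : Function.Injective U)
    (horth : ∀ φ y, ⟪T φ, U y⟫_ℝ = 0) (htop : LinearMap.range T ⊔ LinearMap.range U = ⊤) :
    ∃ κ : (E × F) ≃L[ℝ] V, ∀ z : E × F, κ z = T z.1 + U z.2 :=
  ⟨(LinearEquiv.ofBijective (T.coprod U) (coprod_bijective_of_orthogonal hT hU horth htop)).toContinuousLinearEquiv,
    fun z => by simp [LinearMap.coprod_apply]⟩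

/-- ★ **Change of variables from a product of inner product spaces**: for the orthogonal-sum model
`κ(φ, y) = Tφ + Uy` and `Ψ : E × F → V` measurable, injective on a measurable `W` with derivative within `W`:
`dv|_{Ψ(W)} = Ψ_*((|det(Ψ'(z) ∘ κ⁻¹)| · √det(T†T)·√det(U†U)) · (dφ ⊗ dy)|_W)`.
[cite: EvansGariepy2015, §3.2 Thm 3.6 (i), §3.3.1 Lemma 3.1, §3.3.3 (PDF pp. 72–78)]
[cite: Breitung1994, Lemma 3 (2.2) (PDF p. 14); §2.3 Definitions 4–5 pp. 14–15] -/
theorem volume_restrict_image_eq_map_withDensity_prod (hT : Function.Injective T) (hU : Function.Injective U)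
    (horth : ∀ φ y, ⟪T φ, U y⟫_ℝ = 0) (htop : LinearMap.range T ⊔ LinearMap.range U = ⊤)
    (κ : (E × F) ≃L[ℝ] V) (hκ : ∀ z : E × F, κ z = T z.1 + U z.2)
    {Ψ : E × F → V} {W : Set (E × F)} {Ψ' : E × F → (E × F) →L[ℝ] V} (hΨm : Measurable Ψ)
    (hW : MeasurableSet W) (hΨ' : ∀ z ∈ W, HasFDerivWithinAt Ψ (Ψ' z) W z) (hinj : InjOn Ψ W)
    (hΨ'm : Measurable fun z => |((Ψ' z).comp (κ.symm : V →L[ℝ] (E × F))).det|) :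
    (volume : Measure V).restrict (Ψ '' W) =
      ((((volume : Measure E).prod (volume : Measure F)).restrict W).withDensity fun z =>
        ENNReal.ofReal (|((Ψ' z).comp (κ.symm : V →L[ℝ] (E × F))).det| *
          (Real.sqrt (LinearMap.det (LinearMap.adjoint T ∘ₗ T)) *
            Real.sqrt (LinearMap.det (LinearMap.adjoint U ∘ₗ U))))).map Ψ :=
  restrict_image_eq_map_withDensity_of_linearModel_ofReal (volume : Measure V)
    ((volume : Measure E).prod (volume : Measure F)) κ
    (volume_eq_smul_map_prod_volume hT hU horth htop hκ) hΨm hW hΨ' hinj hΨ'm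

variable {𝔸 : Type*} [NormedRing 𝔸] [NormedAlgebra ℂ 𝔸] [CompleteSpace 𝔸]
variable {G : Type*} [Group G] [TopologicalSpace G] [IsTopologicalGroup G] [CompactSpace G]
  [MeasurableSpace G] [BorelSpace G]
variable {C : LogChart 𝔸} {ρ : G →* 𝔸} (h : IsChartRep C ρ) [FiniteDimensional ℝ C.lie]
  (hlie : ∀ x ∈ C.lie, ∀ y ∈ C.lie, x * y - y * x ∈ C.lie)
variable [MeasurableSpace C.lie] [BorelSpace C.lie]
variable (μ : Measure G) [μ.IsHaarMeasure] (e : V ≃L[ℝ] C.lie)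

include hlie in
/-- ★★ **Haar measure in tubular-type coordinates from a product of inner product spaces** (the `hloc` input of
`OrbitTubeMeasure.restrict_tube_eq_map_withDensity_ofReal` ∕ `tendsto_laplaceMethod_orbit`).  For the
orthogonal-sum model `κ(φ, y) = Tφ + Uy : E × F ≃ V` of the frame space of the exponential chart, base point `g₀`,
and a reparametrisation `Ψ : E × F → V` measurable, injective on a measurable `W` with derivative within `W` and
`Ψ(W) ⊆ e⁻¹B(0, s_C∕2)`:
`μ|_{(g₀Θ∘e∘Ψ)(W)} = (g₀Θ∘e∘Ψ)_*((|det(Ψ'(φ,y) ∘ κ⁻¹)| · √det(T†T)√det(U†U) · σ₀ · |det jac(e Ψ(φ,y))|) · (dφ⊗dy)|_W)`.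
[cite: Helgason2000, Ch. I §1 Thm 1.14 (13) p. 96] [cite: Breitung1994, §2.3 Definitions 4–5 pp. 14–15; Thm 41 p. 56]
[cite: EvansGariepy2015, §3.2 Thm 3.6 (i), §3.3.1 Lemma 3.1 (PDF pp. 72–74)] -/
theorem haar_restrict_image_reparam_eq_map_withDensity_prod (hT : Function.Injective T)
    (hU : Function.Injective U) (horth : ∀ φ y, ⟪T φ, U y⟫_ℝ = 0)
    (htop : LinearMap.range T ⊔ LinearMap.range U = ⊤)
    (κ : (E × F) ≃L[ℝ] V) (hκ : ∀ z : E × F, κ z = T z.1 + U z.2) (g₀ : G)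
    {Ψ : E × F → V} {W : Set (E × F)} {Ψ' : E × F → (E × F) →L[ℝ] V} (hΨm : Measurable Ψ)
    (hW : MeasurableSet W) (hΨ' : ∀ z ∈ W, HasFDerivWithinAt Ψ (Ψ' z) W z) (hinj : InjOn Ψ W)
    (hΨ'm : Measurable fun z => |((Ψ' z).comp (κ.symm : V →L[ℝ] (E × F))).det|)
    (hΨW : Ψ '' W ⊆ e ⁻¹' Metric.ball (0 : C.lie) (IsChartRep.chartRadius C / 2)) :
    μ.restrict ((fun z => g₀ * h.expChart (e (Ψ z))) '' W) =
      ((((volume : Measure E).prod (volume : Measure F)).restrict W).withDensity fun z => ENNReal.ofReal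
          (|((Ψ' z).comp (κ.symm : V →L[ℝ] (E × F))).det| *
            (Real.sqrt (LinearMap.det (LinearMap.adjoint T ∘ₗ T)) *
              Real.sqrt (LinearMap.det (LinearMap.adjoint U ∘ₗ U))) *
            ((μ (h.window (IsChartRep.chartRadius C)) /
                h.chartMeasure hlie ((volume : Measure V).map e) (IsChartRep.chartRadius C)
                  (h.window (IsChartRep.chartRadius C))).toReal *
              |LinearMap.det (jac hlie (e (Ψ z)) : C.lie →ₗ[ℝ] C.lie)|))).map
        (fun z => g₀ * h.expChart (e (Ψ z))) :=
  haar_restrict_image_reparam_eq_map_withDensity_linearModel h hlie μ e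
    ((volume : Measure E).prod (volume : Measure F)) κ g₀ (mul_nonneg (Real.sqrt_nonneg _) (Real.sqrt_nonneg _))
    (volume_eq_smul_map_prod_volume hT hU horth htop hκ) hΨm hW hΨ' hinj hΨ'm hΨW

end Prod

end Literature.Analysis.Asymptotics
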